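import Literature.Probability.Percolation.BoxCrossingUpperBound
import Literature.Topology.PlaneTopology.CrosscutProofs
import HarnessLib

/-!
# RSW bounds for conformal rectangles: the closed theorems

Topic: Probability / Percolation. This short file closes the conditional RSW bounds of
`BoxCrossingLowerBound.lean` / `BoxCrossingUpperBound.lean` now that both plane-topology inputs
are theorems of the tree — the Jordan curve theorem (`Literature.Topology.PlaneTopology.JordanCurveTheorem_holds`,
`Topology/PlaneTopology/JordanCurveProofs.lean`) and Newman's cross-cut theorem
(`Literature.Topology.PlaneTopology.Newman1939_crosscut_holds`, `Topology/PlaneTopology/CrosscutProofs.lean`):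

* `Literature.Probability.Percolation.discreteCrossingProb_bounds_nullFrontier_holds` **discharges the named fact**
  `Literature.Probability.Percolation.discreteCrossingProb_bounds_nullFrontier` (`BoxCrossing.lean`; Grimmett,
  *Probability on Graphs* (2018), §5.7 p. 176 and Exercises 5.5–5.6 p. 186, resting on the `ℤ²`
  RSW bounds of Grimmett, *Percolation* (1999), §11.7 (11.70)/(11.72)): for a conformal rectangle
  whose boundary curve is Lebesgue-null, the probability at `p = 1/2` of an open crossing of
  `Ω_δ` between the discretised arcs `A₀`, `A₂` is bounded away from `0` and `1` uniformly in
  small `δ`.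
* `discreteCrossingProb_upperBound_holds`: the upper bound `≤ c₂ < 1` for **every** conformal
  rectangle (no hypothesis on the boundary), and its cluster-point form
  `lt_one_of_mapClusterPt_discreteCrossingProb_holds`.
* `discreteCrossingProb_lowerBound_of_bulk`: the lower bound `≥ c₁ > 0` for every conformal
  rectangle whose discretisation is eventually *bulk-dominated* (every compact `K ⊆ Ω` has all its
  mesh points in the largest mesh component `meshDomain Ω δ` for small `δ`), and
  `Literature.Probability.Percolation.discreteCrossingProb_clusterPt_mem_Ioo_of_bulk`: the original fact
  `discreteCrossingProb_clusterPt_mem_Ioo` (all conformal rectangles) follows from that purely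
  deterministic discretisation property alone — which holds when `volume (frontier Ω) = 0`
  (`MeshDomainBulk.lean`) and is not known to us (no source, no proof, no counterexample) for
  Jordan curves of positive area; see the docstring of `discreteCrossingProb_bounds_nullFrontier`.

## References
* G. Grimmett, *Probability on Graphs*, 2nd ed., CUP (2018), §5.7 p. 176, Ex. 5.5–5.6 p. 186.
  [Grimmett2018]
* G. Grimmett, *Percolation*, 2nd ed., Springer (1999), §11.7, Thm (11.70), eq. (11.72).
  [GrimmettPercolation1999]
* M. H. A. Newman, *Elements of the topology of plane sets of points*, CUP (1939), Ch. V §11.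
  [Newman1939]
-/

noncomputable section

open MeasureTheory Filter Set Topology

namespace Literature.Probability.Percolation

/-- **RSW upper bound for every conformal rectangle** (closed form of
`discreteCrossingProb_upperBound`): there are `c₂ < 1` and `δ₀ > 0` with
`P_{1/2}(A₀ ↔ A₂ in Ω_δ) ≤ c₂` for all `0 < δ < δ₀`. (Grimmett 2018, §5.7: "uniformly bounded away
from … 1 as δ → 0".) [cite: Grimmett2018, §5.7 p. 176 and Exercise 5.6 p. 186] -/
theorem discreteCrossingProb_upperBound_holds (R : RandomPlanarGeometry.ConformalRectangle) :
    ∃ c₂ δ₀ : ℝ, c₂ < 1 ∧ 0 < δ₀ ∧ ∀ δ : ℝ, 0 < δ → δ < δ₀ →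
      discreteCrossingProb half R.carrier δ (R.arc 0) (R.arc 2) ≤ c₂ :=
  discreteCrossingProb_upperBound Literature.Probability.Percolation.rsw_half_holds
    Literature.Probability.Percolation.Grimmett1999_openCircuitAround_half_holds Literature.Topology.PlaneTopology.JordanCurveTheorem_holds
    Literature.Topology.PlaneTopology.Newman1939_crosscut_holds R

/-- **RSW lower bound for bulk-dominated discretisations** (closed form of
`discreteCrossingProb_lowerBound`): if every compact `K ⊆ Ω` has all its mesh points in the
discrete domain `meshDomain Ω δ` (the largest mesh component) for all small `δ`, then there are
`c₁ > 0` and `δ₀ > 0` with `c₁ ≤ P_{1/2}(A₀ ↔ A₂ in Ω_δ)` for all `0 < δ < δ₀`.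
[cite: Grimmett2018, §5.7 p. 176 and Exercises 5.5–5.6 p. 186] -/
theorem discreteCrossingProb_lowerBound_of_bulk (R : RandomPlanarGeometry.ConformalRectangle)
    (hbulk : ∀ K : Set ℂ, IsCompact K → K ⊆ R.carrier → ∃ δ₀ > 0, ∀ δ : ℝ, 0 < δ → δ < δ₀ →
      ∀ x : LatticeModels.Site 2, LatticeModels.meshPoint δ x ∈ K → x ∈ LatticeModels.meshDomain R.carrier δ) :
    ∃ c₁ δ₀ : ℝ, 0 < c₁ ∧ 0 < δ₀ ∧ ∀ δ : ℝ, 0 < δ → δ < δ₀ →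
      c₁ ≤ discreteCrossingProb half R.carrier δ (R.arc 0) (R.arc 2) :=
  discreteCrossingProb_lowerBound Literature.Probability.Percolation.rsw_half_holds
    Literature.Probability.Percolation.Grimmett1999_openCircuitAround_half_holds Literature.Topology.PlaneTopology.JordanCurveTheorem_holds R hbulk

/-- **RSW lower bound for conformal rectangles with Lebesgue-null boundary** (closed form of
`discreteCrossingProb_lowerBound_of_nullFrontier`). [cite: Grimmett2018, §5.7 p. 176 and Exercises 5.5–5.6 p. 186] -/
theorem discreteCrossingProb_lowerBound_holds (R : RandomPlanarGeometry.ConformalRectangle)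
    (hR : volume (frontier R.carrier) = 0) :
    ∃ c₁ δ₀ : ℝ, 0 < c₁ ∧ 0 < δ₀ ∧ ∀ δ : ℝ, 0 < δ → δ < δ₀ →
      c₁ ≤ discreteCrossingProb half R.carrier δ (R.arc 0) (R.arc 2) :=
  discreteCrossingProb_lowerBound_of_nullFrontier Literature.Probability.Percolation.rsw_half_holds
    Literature.Probability.Percolation.Grimmett1999_openCircuitAround_half_holds Literature.Topology.PlaneTopology.JordanCurveTheorem_holds R hR

/-- **Every subsequential limit of the crossing probability is `< 1`**, for every conformal
rectangle (the upper half of `Literature.Probability.Percolation.discreteCrossingProb_clusterPt_mem_Ioo`, now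
unconditional). [cite: Grimmett2018, §5.7 p. 176 and Exercise 5.6 p. 186] -/
theorem lt_one_of_mapClusterPt_discreteCrossingProb_holds (R : RandomPlanarGeometry.ConformalRectangle)
    {a : ℝ} (ha : MapClusterPt a (𝓝[>] 0) fun δ =>
      discreteCrossingProb half R.carrier δ (R.arc 0) (R.arc 2)) :
    a < 1 :=
  lt_one_of_mapClusterPt_discreteCrossingProb_of_JCT Literature.Topology.PlaneTopology.JordanCurveTheorem_holds
    Literature.Topology.PlaneTopology.Newman1939_crosscut_holds R ha

end Literature.Probability.Percolation

namespace Literature.Probability.Percolation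

open LatticeModels

/-- **The corrected RSW fact holds.** Discharges the named fact
`discreteCrossingProb_bounds_nullFrontier` (`BoxCrossing.lean`): for every conformal rectangle
with `volume (frontier Ω) = 0` there are `0 < c₁`, `c₂ < 1`, `δ₀ > 0` with
`c₁ ≤ P_{1/2}(A₀ ↔ A₂ in Ω_δ) ≤ c₂` for all `0 < δ < δ₀`. Inputs, all theorems of the tree: the
`ℤ²` box-crossing property `rsw_half_holds` (Bollobás–Riordan 2006, Ch. 3), the annulus bound
`Grimmett1999_openCircuitAround_half_holds` (Grimmett 1999, (11.72)), the Jordan curve theorem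
`JordanCurveTheorem_holds` and Newman's cross-cut theorem `Newman1939_crosscut_holds`.
[cite: Grimmett2018, §5.7 p. 176 and Exercises 5.5–5.6 p. 186] -/
theorem discreteCrossingProb_bounds_nullFrontier_holds : discreteCrossingProb_bounds_nullFrontier :=
  discreteCrossingProb_bounds_nullFrontier_of_JCT Literature.Topology.PlaneTopology.JordanCurveTheorem_holds Literature.Topology.PlaneTopology.Newman1939_crosscut_holds

/-- **Cluster points in `(0, 1)` for conformal rectangles with Lebesgue-null boundary**: the
statement of `discreteCrossingProb_clusterPt_mem_Ioo` under the proviso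
`volume (frontier Ω) = 0` (rectifiable, e.g. polygonal or piecewise-smooth, boundaries), now
unconditional. [cite: Grimmett2018, §5.7 p. 176 and Exercise 5.6 p. 186] -/
theorem discreteCrossingProb_clusterPt_mem_Ioo_of_volume_frontier (R : RandomPlanarGeometry.ConformalRectangle)
    (hR : volume (frontier R.carrier) = 0) {c : ℝ}
    (hc : MapClusterPt c (𝓝[>] 0) fun δ =>
      discreteCrossingProb half R.carrier δ (R.arc 0) (R.arc 2)) :
    c ∈ Set.Ioo (0 : ℝ) 1 :=
  discreteCrossingProb_bounds_nullFrontier_holds.clusterPt_mem_Ioo R hR hc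

/-- **What remains of the original fact.** `discreteCrossingProb_clusterPt_mem_Ioo` (all
conformal rectangles, H21's largest-component discretisation `meshDomain`) follows from the
purely deterministic *bulk property* of the discretisation: for every conformal rectangle and
every compact `K ⊆ Ω`, all mesh points of `K` lie in `meshDomain Ω δ` for all small `δ`. This
property holds when `volume (frontier Ω) = 0` (`exists_forall_mem_meshDomain_and_reachable`,
`MeshDomainBulk.lean`); for Jordan curves of positive area it is open to us (see
`discreteCrossingProb_bounds_nullFrontier`). [cite: Grimmett2018, §5.7 p. 176 and Exercise 5.6 p. 186] -/
theorem discreteCrossingProb_clusterPt_mem_Ioo_of_bulk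
    (hbulk : ∀ (R : RandomPlanarGeometry.ConformalRectangle) (K : Set ℂ), IsCompact K → K ⊆ R.carrier →
      ∃ δ₀ > 0, ∀ δ : ℝ, 0 < δ → δ < δ₀ →
        ∀ x : Site 2, meshPoint δ x ∈ K → x ∈ meshDomain R.carrier δ) :
    discreteCrossingProb_clusterPt_mem_Ioo := by
  refine discreteCrossingProb_clusterPt_mem_Ioo_of_bounds fun R => ?_
  obtain ⟨c₁, δ₁, hc₁, hδ₁, hlow⟩ := discreteCrossingProb_lowerBound_of_bulk R (hbulk R)
  obtain ⟨c₂, δ₂, hc₂, hδ₂, hup⟩ := discreteCrossingProb_upperBound_holds R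
  exact ⟨c₁, c₂, min δ₁ δ₂, hc₁, hc₂, lt_min hδ₁ hδ₂, fun δ hδ hδlt =>
    ⟨hlow δ hδ (hδlt.trans_le (min_le_left _ _)), hup δ hδ (hδlt.trans_le (min_le_right _ _))⟩⟩

end Literature.Probability.Percolation
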